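import Summits.SmoothPoincare4.SmoothPoincare4.Theses.SymplecticCap
import Literature.Geometry.Symplectic.GromovCompactnessSpheresProofs
import Literature.Geometry.Symplectic.GromovCompactnessSpheresEnergy

/-!
# Birth skeleton — split piece X₃ `GromovCompactnessSpheres` (stmt-SmoothPoincare4-16777)

BC3 skeleton for the third piece of the typed split of crux `GromovRecognitionRelEnd`
(stmt-SmoothPoincare4-11009, route SymplecticCap). The piece is Gromov compactness for
`J`-spheres in a fixed homotopy class, DICHOTOMY form (= the Literature named fact
`Literature.Geometry.Symplectic.gromovCompactness_spheres_dichotomy`, verbatim; Gromov 1985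
1.5.B, McDuff–Salamon 2012 Thm. 5.3.1 with Def. 5.1.1 / Thm. 5.2.2, Hummel 1997 Ch. V,
Wendl 2018 Thm. 4.6): along a subsequence EITHER (A) linear reparametrisations converge
uniformly to a `J`-sphere, OR (B) the energy splits into `m ≥ 2` non-constant `J`-spheres
carrying the class, with Hausdorff convergence of images.

LANDED toward it (fact seats, sorry-free, 2026-08-17): the energy as a homological period and
its constancy on the homotopy class (`period_eq_of_homotopic`, `integral_pullback_glued_eq` —
the energy bound of MS 2012 Thm. 5.3.1), positivity of energy of non-constant `J`-spheres
(`twoChartSphere_period_ne_zero_of_ne`), and the whole ZERO-ENERGY STRATUM of the dichotomy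
(`gromovCompactness_spheres_dichotomy_of_period_eq_zero`: alternative (A) with identity
reparametrisations). What is open is the positive-energy case, which this skeleton splits into
the two theorems it is made of:

* `stub_bubblingOrUniformLimit` (XL — the bubbling analysis: conformal rescaling at points of
  energy concentration, energy quantum, removal of singularities, no energy loss / zero distance on
  necks, stability of the limit tree; MS 2012 Ch. 4 and §5.3): along a subsequence, EITHER there
  are linear reparametrisations `[A k]` such that the reparametrised glued maps — asserted to be
  again glued maps of `J`-holomorphic two-chart spheres homotopic to `F₀` (reparametrisation by a
  Möbius map; `GL₂(ℂ)` is connected) — converge UNIFORMLY to SOME continuous `F : ℂP¹ → X`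
  (alternative (A⁰): one-vertex limit tree), OR alternative (B) verbatim.
* `stub_uniformLimitIsJSphere` (L — ε-regularity and elliptic bootstrapping, MS 2012 Thm. 4.1.1 /
  Lemma 4.6.5 / Thm. 4.6.1, plus the energy–diameter quantum that forbids bubbling under `C⁰`
  convergence: a bubble at `z₀` would have to lie in every `F(B_δ(z₀))`, of diameter → 0): a
  UNIFORM limit `F` of glued maps of `J`-spheres in the class of `F₀` (tame `J`, closed `ω`,
  compact `X`) is itself the glued map of a smooth `J`-holomorphic two-chart sphere (the charts
  `u z = F [1 : z]`, `v w = F [w : 1]` are automatically compatible; the content is their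
  smoothness and `J`-holomorphy).

`GromovCompactnessSpheres_of` concludes the piece BY NAME from the two stubs BY NAME: (A⁰) + closedness ⇒
(A); (B) passes through. Sorries: exactly the two stubs; the composition is kernel-checked. Neither stub is the piece
reworded: the first has a strictly weaker alternative (A⁰) (no limit sphere), the second is a
closedness statement about a convergent sequence with no subsequence/bubbling content.
-/

namespace Summit.SmoothPoincare4.SmoothPoincare4.Cruxes.GromovCompactnessSpheres.Birth

open scoped Manifold ContDiff Topology
open Set Function Literature.Topology.FourManifolds Literature.Topology.FourManifolds.ComplexProjectiveSpace
open Literature.Geometry.Kaehler Literature.AlgebraicTopology.SingularHomology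
open Literature.Geometry.Symplectic

/-- **Stub P3 — bubbling or uniform limit (XL; MS 2012 Thm. 5.3.1 / 5.2.2, Ch. 4).** Gromov
compactness with alternative (A) weakened to (A⁰): uniform convergence of linearly reparametrised
spheres of the sequence (which are again `J`-two-chart spheres in the class of `F₀`) to SOME
continuous map. -/
theorem stub_bubblingOrUniformLimit :
    ∀ (X : Type) [TopologicalSpace X] [T2Space X] [SecondCountableTopology X] [CompactSpace X]
      [ChartedSpace (EuclideanSpace ℝ (Fin 4)) X] [IsManifold (𝓡 4) ∞ X]
      (ωX : MForm (𝓡 4) X ℝ 2) (JX : AlmostComplexStructure (𝓡 4) ∞ X)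
      (us vs : ℕ → ℂ → X) (Fs : ℕ → C(ComplexProjectiveSpace 1, X)) (F₀ : C(ComplexProjectiveSpace 1, X)),
      IsSmoothForm ωX → IsClosedForm ωX → JX.IsTamedBy ωX →
      (∀ n, ContMDiff 𝓘(ℝ, ℂ) (𝓡 4) ∞ (us n) ∧ ContMDiff 𝓘(ℝ, ℂ) (𝓡 4) ∞ (vs n) ∧
        (∀ z : ℂ, z ≠ 0 → vs n z = us n z⁻¹) ∧
        IsJHolomorphic (𝓡 4) (fun y => JX y) (us n) ∧ IsJHolomorphic (𝓡 4) (fun y => JX y) (vs n) ∧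
        (∀ p, CoordNeZero 0 p → Fs n p = us n (affineCoordComplex 0 p 0)) ∧
        (∀ p, CoordNeZero 1 p → Fs n p = vs n (affineCoordComplex 1 p 0)) ∧
        (Fs n).Homotopic F₀) →
      ∃ φ : ℕ → ℕ, StrictMono φ ∧
       ((∃ (F : C(ComplexProjectiveSpace 1, X)) (A : ℕ → ((Fin 2 → ℂ) ≃ₗ[ℂ] (Fin 2 → ℂ))),
           (∀ k, (∃ (u v : ℂ → X), ContMDiff 𝓘(ℝ, ℂ) (𝓡 4) ∞ u ∧ ContMDiff 𝓘(ℝ, ℂ) (𝓡 4) ∞ v ∧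
             (∀ z : ℂ, z ≠ 0 → v z = u z⁻¹) ∧
             IsJHolomorphic (𝓡 4) (fun y => JX y) u ∧ IsJHolomorphic (𝓡 4) (fun y => JX y) v ∧
             (∀ p, CoordNeZero 0 p → ((Fs (φ k)).comp ⟨PlusOneSpherePair.projectiveMap (A k), PlusOneSpherePair.continuous_projectiveMap (A k)⟩) p = u (affineCoordComplex 0 p 0)) ∧
             (∀ p, CoordNeZero 1 p → ((Fs (φ k)).comp ⟨PlusOneSpherePair.projectiveMap (A k), PlusOneSpherePair.continuous_projectiveMap (A k)⟩) p = v (affineCoordComplex 1 p 0))) ∧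
             ((Fs (φ k)).comp ⟨PlusOneSpherePair.projectiveMap (A k), PlusOneSpherePair.continuous_projectiveMap (A k)⟩).Homotopic F₀) ∧
           Filter.Tendsto (fun k => ((Fs (φ k)).comp ⟨PlusOneSpherePair.projectiveMap (A k), PlusOneSpherePair.continuous_projectiveMap (A k)⟩)) Filter.atTop (𝓝 F)) ∨
        (∃ (m : ℕ) (Bu Bv : Fin m → ℂ → X) (G : Fin m → C(ComplexProjectiveSpace 1, X)), 2 ≤ m ∧
           (∀ j, ContMDiff 𝓘(ℝ, ℂ) (𝓡 4) ∞ (Bu j) ∧ ContMDiff 𝓘(ℝ, ℂ) (𝓡 4) ∞ (Bv j) ∧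
             (∀ z : ℂ, z ≠ 0 → Bv j z = Bu j z⁻¹) ∧
             IsJHolomorphic (𝓡 4) (fun y => JX y) (Bu j) ∧ IsJHolomorphic (𝓡 4) (fun y => JX y) (Bv j) ∧
             (∃ z, Bu j z ≠ Bu j 0) ∧
             (∀ p, CoordNeZero 0 p → G j p = Bu j (affineCoordComplex 0 p 0)) ∧
             (∀ p, CoordNeZero 1 p → G j p = Bv j (affineCoordComplex 1 p 0))) ∧
           (∀ n, ∑ j, singularHomology.map ℤ ℤ (G j) (2 * 1)
               (ComplexProjectiveSpace.homologicalOrientationInt 1).fundamentalClass =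
             singularHomology.map ℤ ℤ (Fs n) (2 * 1)
               (ComplexProjectiveSpace.homologicalOrientationInt 1).fundamentalClass) ∧
           (∀ O : Set X, IsOpen O → (⋃ j, (range (Bu j) ∪ {Bv j 0})) ⊆ O →
             ∀ᶠ k in Filter.atTop, range (us (φ k)) ∪ {vs (φ k) 0} ⊆ O) ∧
           (∀ y ∈ ⋃ j, (range (Bu j) ∪ {Bv j 0}), ∀ O' : Set X, IsOpen O' → y ∈ O' →
             ∀ᶠ k in Filter.atTop, ((range (us (φ k)) ∪ {vs (φ k) 0}) ∩ O').Nonempty))) := by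
  sorry

/-- **Stub P2 — uniform limits of `J`-spheres in a fixed class are `J`-spheres (L; MS 2012
Thm. 4.1.1, §4.6; no bubbling under `C⁰` convergence by the energy–diameter quantum).** -/
theorem stub_uniformLimitIsJSphere :
    ∀ (X : Type) [TopologicalSpace X] [T2Space X] [SecondCountableTopology X] [CompactSpace X]
      [ChartedSpace (EuclideanSpace ℝ (Fin 4)) X] [IsManifold (𝓡 4) ∞ X]
      (ωX : MForm (𝓡 4) X ℝ 2) (JX : AlmostComplexStructure (𝓡 4) ∞ X)
      (Gs : ℕ → C(ComplexProjectiveSpace 1, X)) (F₀ F : C(ComplexProjectiveSpace 1, X)),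
      IsSmoothForm ωX → IsClosedForm ωX → JX.IsTamedBy ωX →
      (∀ k, (∃ (u v : ℂ → X), ContMDiff 𝓘(ℝ, ℂ) (𝓡 4) ∞ u ∧ ContMDiff 𝓘(ℝ, ℂ) (𝓡 4) ∞ v ∧
             (∀ z : ℂ, z ≠ 0 → v z = u z⁻¹) ∧
             IsJHolomorphic (𝓡 4) (fun y => JX y) u ∧ IsJHolomorphic (𝓡 4) (fun y => JX y) v ∧
             (∀ p, CoordNeZero 0 p → Gs k p = u (affineCoordComplex 0 p 0)) ∧
             (∀ p, CoordNeZero 1 p → Gs k p = v (affineCoordComplex 1 p 0))) ∧ (Gs k).Homotopic F₀) →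
      Filter.Tendsto Gs Filter.atTop (𝓝 F) →
      ∃ (u v : ℂ → X), ContMDiff 𝓘(ℝ, ℂ) (𝓡 4) ∞ u ∧ ContMDiff 𝓘(ℝ, ℂ) (𝓡 4) ∞ v ∧
             (∀ z : ℂ, z ≠ 0 → v z = u z⁻¹) ∧
             IsJHolomorphic (𝓡 4) (fun y => JX y) u ∧ IsJHolomorphic (𝓡 4) (fun y => JX y) v ∧
             (∀ p, CoordNeZero 0 p → F p = u (affineCoordComplex 0 p 0)) ∧
             (∀ p, CoordNeZero 1 p → F p = v (affineCoordComplex 1 p 0)) := by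
  sorry

/-- **Composition (kernel-checked, no sorry of its own): the piece BY NAME from the two stubs BY
NAME** — in alternative (A⁰) of `stub_bubblingOrUniformLimit` the closedness stub
`stub_uniformLimitIsJSphere` upgrades the continuous uniform limit to a `J`-sphere, giving (A);
alternative (B) is passed through. -/
theorem GromovCompactnessSpheres_of :
    Summit.SmoothPoincare4.SmoothPoincare4.Theses.SymplecticCap.GromovCompactnessSpheres := by
  intro X _ _ _ _ _ _ ωX JX us vs Fs F₀ hω hcl htame hyp
  obtain ⟨φ, hφ, h⟩ := stub_bubblingOrUniformLimit X ωX JX us vs Fs F₀ hω hcl htame hyp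
  refine ⟨φ, hφ, ?_⟩
  rcases h with ⟨F, A, hG, hlim⟩ | hB
  · obtain ⟨u, v, hu, hv, huv, hJu, hJv, hc0, hc1⟩ :=
      stub_uniformLimitIsJSphere X ωX JX (fun k => ((Fs (φ k)).comp ⟨PlusOneSpherePair.projectiveMap (A k), PlusOneSpherePair.continuous_projectiveMap (A k)⟩)) F₀ F hω hcl htame hG hlim
    exact Or.inl ⟨u, v, F, A, hu, hv, huv, hJu, hJv, hc0, hc1, hlim⟩
  · exact Or.inr hB

/-- The same term closes the Literature named fact (the route decl is this constant). -/
theorem gromovCompactness_spheres_dichotomy_of_birth : gromovCompactness_spheres_dichotomy :=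
  GromovCompactnessSpheres_of

/-- Landed partial result, re-exported for the record: the ZERO-ENERGY stratum of the piece holds
outright (`gromovCompactness_spheres_dichotomy_of_period_eq_zero`, fact seat 2026-08-17). -/
example := @gromovCompactness_spheres_dichotomy_of_period_eq_zero

end Summit.SmoothPoincare4.SmoothPoincare4.Cruxes.GromovCompactnessSpheres.Birth
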